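import Mathlib
import HarnessLib

/-!
# Format C: the Hilbert-type matrix `(1/(n+m))` is positive semidefinite (even-sector DIG_off is droppable)

Route context: Fourier–Galerkin / Schur-complement certificates of Weil positivity on a window ("format C";
cell memo `run/shared/lean/pub/rh-explicit/rh-explicit-weil-10/FORMATC-DESIGN.md` §4.3, DIG_off; supporting
stmt-RiemannHypothesis-0098).  In the EVEN sector the off-diagonal digamma part of the far Gram contains
`+½·(1/(n+m))_{n,m>M₁}`; §4.3 drops it because `(1/(n+m))` is the Gram matrix of `e^{−nx}` in `L²(0,∞)`
(equivalently of `t^{n−½}` on `(0,1)`), hence positive semidefinite.  (In the ODD sector the same matrix enters with a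
minus sign and is absorbed into the diagonal instead: `WeilFormatCHilbertPartBound.lean`, `…LogBound.lean`.)

* `WeilFormatC.hilbertPart_nonneg` — for every finite set `s` of positive integers and every real `y`:
  **`0 ≤ Σ_{n∈s} Σ_{m∈s} y_n y_m/(n+m)`** (`1/(n+m) = ∫₀^∞ e^{−(n+m)x} dx`, so the form is `∫₀^∞ (Σ_n y_n e^{−nx})² dx`).

Elementary (one improper exponential integral from Mathlib); standard axioms only.
-/

-- `Summit.RiemannHypothesis.RiemannHypothesis.…` is the layout-mandated namespace (summit = problem name).
set_option linter.dupNamespace false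

noncomputable section

open MeasureTheory Set Finset

namespace Summit.RiemannHypothesis.RiemannHypothesis.Theorems.WeilFormatC

/-- `1/(n+m) = ∫₀^∞ e^{−(n+m)x} dx` for `n + m > 0`. -/
theorem inv_add_eq_integral_exp {k : ℝ} (hk : 0 < k) :
    1 / k = ∫ x in Ioi (0 : ℝ), Real.exp (-k * x) := by
  rw [integral_exp_mul_Ioi (by linarith : -k < 0) 0]
  simp only [mul_zero, Real.exp_zero, neg_div, one_div]
  rw [inv_neg, neg_neg]

/-- **`(1/(n+m))_{n,m ∈ s}` is positive semidefinite** on any finite set `s` of positive integers: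
`0 ≤ Σ_n Σ_m y_n y_m /(n+m)`. -/
theorem hilbertPart_nonneg (s : Finset ℕ) (hs : ∀ n ∈ s, 1 ≤ n) (y : ℕ → ℝ) :
    0 ≤ ∑ n ∈ s, ∑ m ∈ s, y n * (1 / ((n : ℝ) + m)) * y m := by
  -- each term as an integral
  have hpos : ∀ n ∈ s, (0 : ℝ) < n := fun n hn ↦ by exact_mod_cast (hs n hn)
  have hterm : ∀ n ∈ s, ∀ m ∈ s, y n * (1 / ((n : ℝ) + m)) * y m
      = ∫ x in Ioi (0 : ℝ), y n * Real.exp (-(n : ℝ) * x) * (y m * Real.exp (-(m : ℝ) * x)) := by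
    intro n hn m hm
    have hk : (0 : ℝ) < n + m := by linarith [hpos n hn, hpos m hm]
    rw [inv_add_eq_integral_exp hk, ← integral_const_mul, ← integral_mul_const]
    refine setIntegral_congr_fun measurableSet_Ioi fun x _ ↦ ?_
    have : Real.exp (-((n : ℝ) + m) * x) = Real.exp (-(n : ℝ) * x) * Real.exp (-(m : ℝ) * x) := by
      rw [← Real.exp_add]; congr 1; ring
    rw [this]; ring
  have hint : ∀ n ∈ s, ∀ m ∈ s,
      IntegrableOn (fun x : ℝ ↦ y n * Real.exp (-(n : ℝ) * x) * (y m * Real.exp (-(m : ℝ) * x))) (Ioi 0) := by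
    intro n hn m hm
    have hk : -((n : ℝ) + m) < 0 := by linarith [hpos n hn, hpos m hm]
    have h : IntegrableOn (fun x : ℝ ↦ (y n * y m) * Real.exp (-((n : ℝ) + m) * x)) (Ioi 0) :=
      (integrableOn_exp_mul_Ioi hk 0).const_mul (y n * y m)
    refine IntegrableOn.congr_fun h (fun x _ ↦ ?_) measurableSet_Ioi
    have : Real.exp (-((n : ℝ) + m) * x) = Real.exp (-(n : ℝ) * x) * Real.exp (-(m : ℝ) * x) := by
      rw [← Real.exp_add]; congr 1; ring
    rw [this]; ring
  -- rewrite the double sum as the integral of a double sum, then of a square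
  set f : ℕ → ℕ → ℝ → ℝ := fun n m x ↦ y n * Real.exp (-(n : ℝ) * x) * (y m * Real.exp (-(m : ℝ) * x)) with hf
  have h1 : ∀ n ∈ s, ∑ m ∈ s, y n * (1 / ((n : ℝ) + m)) * y m = ∫ x in Ioi (0 : ℝ), ∑ m ∈ s, f n m x := by
    intro n hn
    rw [integral_finsetSum _ (fun m hm ↦ hint n hn m hm)]
    exact Finset.sum_congr rfl fun m hm ↦ hterm n hn m hm
  have h2 : ∑ n ∈ s, ∑ m ∈ s, y n * (1 / ((n : ℝ) + m)) * y m
      = ∫ x in Ioi (0 : ℝ), ∑ n ∈ s, ∑ m ∈ s, f n m x := by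
    rw [integral_finsetSum _ (fun n hn ↦ integrable_finsetSum _ (fun m hm ↦ hint n hn m hm))]
    exact Finset.sum_congr rfl h1
  rw [h2]
  refine setIntegral_nonneg measurableSet_Ioi fun x _ ↦ ?_
  have hsq : ∑ n ∈ s, ∑ m ∈ s, f n m x = (∑ n ∈ s, y n * Real.exp (-(n : ℝ) * x)) ^ 2 := by
    rw [sq, Finset.sum_mul_sum]
  rw [hsq]
  exact sq_nonneg _

end Summit.RiemannHypothesis.RiemannHypothesis.Theorems.WeilFormatC
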